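import Summits.RiemannHypothesis.RiemannHypothesis.Theorems.HandoffCrossArch
import Literature.NumberTheory.LFunctions.WeilGroundEnergyParitySplit
import HarnessLib

/-!
# HANDOFF, edge block: the PARITY SPLIT and the EVEN sector uniformly in the gap ratio (rh-explicit, track «HANDOFF», seat prove-2 gen2, ATTEMPT-6)

HONEST FRAMING. Nothing here bears on RH. `EdgeNonneg q q′ η` (`HandoffSchur.lean`: Weil positivity on the two-lobe edge
functions of the window of the consecutive primes `q < q′`) is a NECESSARY piece of `H(q)` and nowhere near RH-strength. This file
proves:

* `EdgeNonnegEven`, `EdgeNonnegOdd`, `edgeNonneg_iff_even_and_odd` — Weil's form is parity-diagonal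
  (`weilQuadratic_eq_evenPart_add_oddPart`), and the even / odd parts of an edge-layer function are edge-layer functions, so the
  edge block splits into an even and an odd half (PROVED).
* `weilPolarTerm_cross_reflect`, `weilFunctional_cross_comp_neg_eq`, `re_weilFunctional_cross_reflect_ge` — for a lobe `f` and its mirror image `f(-·)` the two
  cross kernels have the SAME Weil energy and their polar part is `|f̂(0)|² + |f̂(1)|² ≥ 0`: in the EVEN sector the polar mass of
  the prime-free gap HELPS (in the odd sector it is the same quantity with a minus sign — ATTEMPT-4 (GAP-q)) (PROVED).
* `re_weilQuadratic_lobe_ge_param` — the PARAMETRIC lobe coercivity (Bombieri (12.3)–(12.9) with a free level `K ≥ 2`, the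
  tree's `weilArchQuadratic_ge_param`, moved to an arbitrary interval of length `D ≤ log 2` by translation):
  `Re Q(f) ≥ lobeCoercivity D K · ∫‖f‖²` (PROVED). At `D ≈ 10⁻²…10⁻⁵` this is `≈ 0.7·log(1/D) − 3`, far above Theorem 12's
  `log(1/D) − log⁺log(1/D) − 8`.
* `handoffCrossConstEven`, `edgeNonnegEven_of_ineq` — the even half of the edge block follows from the single explicit
  inequality `4·M(c′)(b − c′) + 2·gapAtomSum(c′, b) ≤ lobeCoercivity (b − c′) K` (some `K ≥ 2`) on the window: NO `e^b·(b − c′)`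
  (polar-mass-of-the-gap) term. ATTEMPT-6 §3: this inequality holds for EVERY consecutive pair `1361 ≤ q ≤ 3·10⁶` (sieve, DERIVED)
  and for all larger `q` from any explicit gap bound `q′ ≤ q(1 + 1/(2 log² q))` (Dusart-type, PROVED in print) — the even half of
  the edge block is gap-RATIO strength; the odd half alone carries the Cramér-order proviso of ATTEMPT-4.
-/

set_option linter.dupNamespace false

noncomputable section

open Complex Filter Set MeasureTheory Literature.NumberTheory.LFunctions
open scoped Real Topology ComplexConjugate ContDiff

namespace Summit.RiemannHypothesis.RiemannHypothesis.Theorems.Handoff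

variable {f g h : ℝ → ℂ} {q q' : ℕ}

/-! ## §1 The parity classes of the edge block -/

/-- The EVEN half of the edge block: Weil positivity on even edge-layer functions of the window. [this track, ATTEMPT-6 §1] -/
def EdgeNonnegEven (q q' : ℕ) (η : ℝ) : Prop :=
  ∀ b ∈ Icc (Real.log q / 2) (Real.log q' / 2), ∀ h : ℝ → ℂ, IsEdgeLayer q η b h → (∀ x, h (-x) = h x) →
    0 ≤ (weilQuadratic h).re

/-- The ODD half of the edge block: Weil positivity on odd edge-layer functions of the window. [this track, ATTEMPT-6 §1] -/
def EdgeNonnegOdd (q q' : ℕ) (η : ℝ) : Prop :=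
  ∀ b ∈ Icc (Real.log q / 2) (Real.log q' / 2), ∀ h : ℝ → ℂ, IsEdgeLayer q η b h → (∀ x, h (-x) = -h x) →
    0 ≤ (weilQuadratic h).re

/-- The even part of an edge-layer function is an edge-layer function. [folklore] -/
theorem IsEdgeLayer.evenPart {η b : ℝ} (hh : IsEdgeLayer q η b h) :
    IsEdgeLayer q η b (fun t ↦ (h t + h (-t)) / 2) := by
  refine ⟨hh.1.evenPart, tsupport_subset_Icc_of_symm hh.2.1 (fun s h1 h2 ↦ by simp [h1, h2]), fun x hx ↦ ?_⟩
  have h1 : h x = 0 := hh.2.2 x hx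
  have h2 : h (-x) = 0 := hh.2.2 (-x) (by rwa [abs_neg])
  simp [h1, h2]

/-- The odd part of an edge-layer function is an edge-layer function. [folklore] -/
theorem IsEdgeLayer.oddPart {η b : ℝ} (hh : IsEdgeLayer q η b h) :
    IsEdgeLayer q η b (fun t ↦ (h t - h (-t)) / 2) := by
  refine ⟨hh.1.oddPart, tsupport_subset_Icc_of_symm hh.2.1 (fun s h1 h2 ↦ by simp [h1, h2]), fun x hx ↦ ?_⟩
  have h1 : h x = 0 := hh.2.2 x hx
  have h2 : h (-x) = 0 := hh.2.2 (-x) (by rwa [abs_neg])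
  simp [h1, h2]

/-- **The edge block splits by parity**: `EdgeNonneg q q′ η ↔ EdgeNonnegEven q q′ η ∧ EdgeNonnegOdd q q′ η` (Weil's form is
parity-diagonal, `weilQuadratic_eq_evenPart_add_oddPart`). [cite: ConnesConsani2023, §2.1.3 eq. QW_λ = QW_λ⁺ ⊕ QW_λ⁻; this track, ATTEMPT-6 §1] -/
theorem edgeNonneg_iff_even_and_odd (q q' : ℕ) (η : ℝ) :
    EdgeNonneg q q' η ↔ EdgeNonnegEven q q' η ∧ EdgeNonnegOdd q q' η := by
  constructor
  · intro hE
    exact ⟨fun b hb h hh _ ↦ hE b hb h hh, fun b hb h hh _ ↦ hE b hb h hh⟩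
  · rintro ⟨hev, hod⟩ b hb h hh
    rw [weilQuadratic_eq_evenPart_add_oddPart hh.1, Complex.add_re]
    refine add_nonneg (hev b hb _ hh.evenPart fun x ↦ ?_) (hod b hb _ hh.oddPart fun x ↦ ?_)
    · simp only [neg_neg]; ring
    · simp only [neg_neg]; ring

/-! ## §2 The symmetric two-lobe split of an even edge-layer function -/

/-- `χ(−x) = 1 − χ(x)` for the smooth step across `[−c, c]` (`c ≠ 0`), from
`smoothTransition x + smoothTransition (1 − x) = 1`. [folklore] -/
theorem edgeStep_neg {c : ℝ} (hc : c ≠ 0) (x : ℝ) : edgeStep c (-x) = 1 - edgeStep c x := by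
  have hsym : ∀ y : ℝ, Real.smoothTransition y + Real.smoothTransition (1 - y) = 1 := by
    intro y
    have hd := Real.smoothTransition.pos_denom y
    rw [Real.smoothTransition, Real.smoothTransition, sub_sub_cancel,
      add_comm (expNegInvGlue (1 - y)) (expNegInvGlue y), ← add_div, div_self hd.ne']
  have e : (-x + c) / (2 * c) = 1 - (x + c) / (2 * c) := by
    field_simp
    ring
  unfold edgeStep
  rw [e]
  linarith [hsym ((x + c) / (2 * c))]

/-- For an EVEN `h` the left lobe is the mirror image of the right lobe: `h₋ = h₊(−·)`. [this track, ATTEMPT-6 §2] -/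
theorem edgeLobeLeft_eq_comp_neg_of_even {c : ℝ} (hc : c ≠ 0) (heven : ∀ x, h (-x) = h x) :
    edgeLobeLeft c h = fun x ↦ edgeLobeRight c h (-x) := by
  funext x
  simp only [edgeLobeLeft, edgeLobeRight, edgeStep_neg hc, heven]

/-! ## §3 A lobe against its mirror image: one cross energy, non-negative polar part -/

/-- The two cross kernels of a lobe `f` and its mirror image `g = f(−·)` are reflections of each other:
`g ⋆ f̃ = (f ⋆ g̃)(−·)`. [folklore] -/
theorem weilConv_weilReflect_comp_neg_eq (f : ℝ → ℂ) :
    weilConv (fun x ↦ f (-x)) (weilReflect f) = fun y ↦ weilConv f (weilReflect fun x ↦ f (-x)) (-y) := by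
  have h := weilConv_comp_neg (fun x ↦ f (-x)) (weilReflect f)
  simp only [neg_neg] at h
  rw [← weilReflect_comp_neg] at h
  -- h : weilConv f (weilReflect fun x ↦ f (-x)) = fun t ↦ weilConv (fun x ↦ f (-x)) (weilReflect f) (-t)
  funext y
  have := congrFun h (-y)
  simp only [neg_neg] at this
  exact this.symm

/-- Hence the two cross energies coincide: `W(g ⋆ f̃) = W(f ⋆ g̃)` for `g = f(−·)` (Weil's distribution is even,
`weilFunctional_comp_neg`). [folklore] -/
theorem weilFunctional_cross_comp_neg_eq (f : ℝ → ℂ) :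
    weilFunctional (weilConv (fun x ↦ f (-x)) (weilReflect f)) =
      weilFunctional (weilConv f (weilReflect fun x ↦ f (-x))) := by
  rw [weilConv_weilReflect_comp_neg_eq, weilFunctional_comp_neg]

/-- **Polar part of the mirror cross kernel.** For a Weil test function `f` and `g = f(−·)`:
`polar(f ⋆ g̃) = |f̂(0)|² + |f̂(1)|²` (Mellin factorisation `(f ⋆ g̃)^(s) = f̂(s)·conj ĝ(1 − s̄)` and `ĝ(s) = f̂(1 − s)`).
In the even sector the polar mass of the gap is therefore NON-NEGATIVE. [cite: Bombieri2000Weil, §2–§3 (f̃*(s) = f̃(1−s), Mellin of a convolution); this track, ATTEMPT-6 §2] -/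
theorem weilPolarTerm_cross_reflect (hf : IsWeilTest f) :
    weilPolarTerm (weilConv f (weilReflect fun x ↦ f (-x))) =
      ((Complex.normSq (weilMellin f 0) + Complex.normSq (weilMellin f 1) : ℝ) : ℂ) := by
  have hg : IsWeilTest (fun x ↦ f (-x)) := hf.comp_neg
  have hM : ∀ s : ℂ, weilMellin (weilConv f (weilReflect fun x ↦ f (-x))) s =
      weilMellin f s * conj (weilMellin (fun x ↦ f (-x)) (1 - conj s)) := by
    intro s
    rw [weilMellin_weilConv_holds hf.1.continuous hf.2 hg.weilReflect.1.continuous hg.weilReflect.2,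
      weilMellin_weilReflect_holds]
  unfold weilPolarTerm
  rw [hM 0, hM 1, weilMellin_comp_neg, weilMellin_comp_neg]
  simp only [map_zero, map_one, sub_zero, sub_self]
  rw [Complex.mul_conj, Complex.mul_conj]
  push_cast
  ring

/-- Real form: `Re polar(f ⋆ g̃) = |f̂(0)|² + |f̂(1)|² ≥ 0` for `g = f(−·)`. [this track, ATTEMPT-6 §2] -/
theorem re_weilPolarTerm_cross_reflect_nonneg (hf : IsWeilTest f) :
    0 ≤ (weilPolarTerm (weilConv f (weilReflect fun x ↦ f (-x)))).re := by
  rw [weilPolarTerm_cross_reflect hf, Complex.ofReal_re]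
  exact add_nonneg (Complex.normSq_nonneg _) (Complex.normSq_nonneg _)

/-! ## §4 The even cross constant and the signed cross bound -/

/-- The EVEN cross constant of ATTEMPT-6: `X_ev(b) = 4·M(c′)·(b − c′) + 2·gapAtomSum(c′, b)`, `c′ = (log q)/2 − η` — the constant
`handoffCrossConst` of ATTEMPT-4 WITHOUT its polar part `(e^b + e^{−c′})(b − c′)`. [this track, ATTEMPT-6 §2] -/
def handoffCrossConstEven (q : ℕ) (η b : ℝ) : ℝ :=
  4 * archGapBound (Real.log q / 2 - η) * (b - (Real.log q / 2 - η)) + 2 * gapAtomSum (Real.log q / 2 - η) b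

/-- **Signed cross bound in the even sector.** For a lobe `f ⊆ [c′, b]` (`0 < c′ ≤ b`) and its mirror image `g = f(−·)`:
`Re(W(f ⋆ g̃) + W(g ⋆ f̃)) ≥ −(4(b − c′)M(c′) + 2·gapAtomSum(c′, b))·(‖f‖₂² + ‖g‖₂²)/… ` precisely
`−(2(b − c′)M(c′) + gapAtomSum(c′,b))·2(‖f‖₂² + ‖g‖₂²) ≤ Re(…)`: the polar part is dropped by sign, the prime and archimedean
parts are bounded as in `handoffCrossBound_holds`. [this track, ATTEMPT-6 §2; cite: Bombieri2000, Thm 2 (prime and archimedean terms)] -/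
theorem re_weilFunctional_cross_reflect_ge (hf : IsWeilTest f) {c' b : ℝ} (hc' : 0 < c') (hcb : c' ≤ b)
    (hfs : tsupport f ⊆ Icc c' b) :
    -((2 * (b - c') * archGapBound c' + gapAtomSum c' b) *
        (2 * ((∫ u : ℝ, ‖f u‖ ^ 2) + ∫ u : ℝ, ‖f (-u)‖ ^ 2))) ≤
      (weilFunctional (weilConv f (weilReflect fun x ↦ f (-x))) +
        weilFunctional (weilConv (fun x ↦ f (-x)) (weilReflect f))).re := by
  set g : ℝ → ℂ := fun x ↦ f (-x) with hg_def
  have hg : IsWeilTest g := hf.comp_neg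
  have hgs : tsupport g ⊆ Icc (-b) (-c') := by
    intro x hx
    have := tsupport_comp_subset_preimage_of_continuous f continuous_neg (by simpa [Function.comp_def] using hx)
    have hm := hfs this
    simp only [Set.mem_Icc] at hm
    exact ⟨by linarith [hm.2], by linarith [hm.1]⟩
  set Nf := ∫ u : ℝ, ‖f u‖ ^ 2 with hNf_def
  set Ng := ∫ u : ℝ, ‖g u‖ ^ 2 with hNg_def
  have hNf : 0 ≤ Nf := integral_nonneg fun _ ↦ by positivity
  have hNg : 0 ≤ Ng := integral_nonneg fun _ ↦ by positivity
  set k := weilConv f (weilReflect g) with hk_def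
  -- the two cross energies coincide
  have hsame : weilFunctional (weilConv g (weilReflect f)) = weilFunctional k := by
    rw [hk_def, hg_def, weilFunctional_cross_comp_neg_eq]
  rw [hsame]
  -- polar ≥ 0, prime and arch bounded
  have hP : 0 ≤ (weilPolarTerm k).re := re_weilPolarTerm_cross_reflect_nonneg hf
  have hPr : ‖weilPrimeTerm k‖ ≤ 2 * gapAtomSum c' b * ((Nf + Ng) / 2) :=
    norm_weilPrimeTerm_le_of_support hc'
      (fun y hy ↦ weilConv_weilReflect_eq_zero_of_lt hfs hgs (by linarith [(abs_lt.1 hy).2]))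
      (fun y hy ↦ by
        rcases lt_or_ge y 0 with h0 | h0
        · exact weilConv_weilReflect_eq_zero_of_lt hfs hgs (by rw [abs_of_neg h0] at hy; linarith)
        · exact weilConv_weilReflect_eq_zero_of_gt hfs hgs (by rw [abs_of_nonneg h0] at hy; linarith))
      (norm_weilConv_weilReflect_le_half_add hf hg)
  have hA : ‖weilArchTerm k‖ ≤ 2 * (b - c') * archGapBound c' * (Nf + Ng) :=
    norm_weilArchTerm_cross_le hf hg hc' hcb hfs hgs
  have hre_pr : -‖weilPrimeTerm k‖ ≤ -(weilPrimeTerm k).re := by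
    have := Complex.abs_re_le_norm (weilPrimeTerm k)
    linarith [(abs_le.1 this).2, le_abs_self ((weilPrimeTerm k).re)]
  have hre_ar : -‖weilArchTerm k‖ ≤ (weilArchTerm k).re := by
    have := Complex.abs_re_le_norm (weilArchTerm k)
    exact (abs_le.1 this).1
  have hW : (weilFunctional k).re = (weilPolarTerm k).re - (weilPrimeTerm k).re + (weilArchTerm k).re := by
    simp [weilFunctional]
  rw [Complex.add_re, hW]
  have hM0 : 0 ≤ archGapBound c' := (archGapBound_pos hc').le
  have hG0 : 0 ≤ gapAtomSum c' b := gapAtomSum_nonneg c' b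
  nlinarith [hP, hPr, hA, hre_pr, hre_ar, hM0, hG0, hNf, hNg]

/-! ## §5 Parametric lobe coercivity (Bombieri (12.3)–(12.9) with a free level `K`) -/

/-- The parametric lobe coercivity constant for a lobe of length `D` at level `K ≥ 2`:
`L_K − log π − 2(sinh(D/2) − D/2) − (D·K/π)(L_K + 4.22745354)`, `L_K = weilLevel K = log(K/2) − 2/K² − π/(2K)`.
[cite: Bombieri2000, §12 eqs. (12.3)–(12.9)] -/
def lobeCoercivity (D K : ℝ) : ℝ :=
  weilLevel K - Real.log π - 2 * (Real.sinh (D / 2) - D / 2) - D * K / π * (weilLevel K + 4.22745354)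

/-- **Parametric self-energy of a lobe.** A Weil test function supported in an interval `[c, d]` of length
`0 < d − c ≤ log 2` has `Re Q(f) ≥ lobeCoercivity (d − c) K · ∫‖f‖²` for every `K ≥ 2` (the tree's `weilArchQuadratic_ge_param`
on `[−a, a]`, `2a = d − c`, where `Re Q = E` since `a ≤ (log 2)/2`; moved to `[c, d]` by translation invariance).
[cite: Bombieri2000, §12 eqs. (12.3)–(12.9); translation = folklore] -/
theorem re_weilQuadratic_lobe_ge_param (hf : IsWeilTest f) {c d : ℝ} (hcd : c < d) (hlen : d - c ≤ Real.log 2)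
    (hsupp : tsupport f ⊆ Icc c d) {K : ℝ} (hK : 2 ≤ K) :
    lobeCoercivity (d - c) K * ∫ t : ℝ, ‖f t‖ ^ 2 ≤ (weilQuadratic f).re := by
  set m : ℝ := (c + d) / 2 with hm
  set a : ℝ := (d - c) / 2 with ha_def
  have ha : 0 < a := by rw [ha_def]; linarith
  have ha2 : a ≤ Real.log 2 / 2 := by rw [ha_def]; linarith
  set g : ℝ → ℂ := fun x ↦ f (x + m) with hg_def
  have hg : IsWeilTest g := isWeilTest_recentre hf m
  have hsupp' : tsupport f ⊆ Icc (m - a) (m + a) := by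
    have e1 : m - a = c := by rw [hm, ha_def]; ring
    have e2 : m + a = d := by rw [hm, ha_def]; ring
    rwa [e1, e2]
  have hgs : tsupport g ⊆ Icc (-a) a := tsupport_recentre_subset hsupp'
  have hgs2 : tsupport g ⊆ Icc (-(Real.log 2 / 2)) (Real.log 2 / 2) :=
    hgs.trans (Icc_subset_Icc (by linarith) ha2)
  have hB := weilArchQuadratic_ge_param hg ha hgs hK
  rw [← weilQuadratic_re_eq_weilArchQuadratic hg hgs2] at hB
  have hback : (fun x ↦ g (x - m)) = f := by
    funext x
    simp [hg_def]
  have hQ : weilQuadratic g = weilQuadratic f := by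
    rw [← hback, weilQuadratic_translate]
  have hN : weilNorm2Sq g = ∫ t : ℝ, ‖f t‖ ^ 2 := by
    unfold weilNorm2Sq
    simp only [hg_def]
    exact integral_add_right_eq_self (fun t : ℝ ↦ ‖f t‖ ^ 2) m
  rw [hQ, hN] at hB
  have hcoef : lobeCoercivity (d - c) K =
      weilLevel K - Real.log π - 2 * (Real.sinh a - a) - 2 * a * K / π * (weilLevel K + 4.22745354) := by
    have e : d - c = 2 * a := by rw [ha_def]; ring
    rw [lobeCoercivity, e]
    ring_nf
  rw [hcoef]
  exact hB

/-! ## §6 The even half of the edge block from one explicit inequality -/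

/-- **The even half of the edge block, reduced.** For consecutive primes `q < q′`, an overlap `0 < η < min((log q)/2, (log 2)/2)`,
and the inequality `X_ev(b) ≤ lobeCoercivity (b − c′) K_b` for some level `K_b ≥ 2` at every `b` in the window
(`c′ = (log q)/2 − η`, `X_ev = handoffCrossConstEven`): `EdgeNonnegEven q q′ η`. Proof: split an even edge-layer `h` into the lobe
`h₊` and its mirror image `h₋ = h₊(−·)`; `Re Q(h) = 2·Re Q(h₊) + 2·Re W(h₊ ⋆ h̃₋)`; the lobe energy is `≥ lobeCoercivity·‖h₊‖²`,
the cross energy is `≥ polar (≥ 0) − prime − arch ≥ −X_ev·‖h₊‖²`. No polar-mass-of-the-gap term enters: the even half is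
gap-RATIO strength (ATTEMPT-6 §3). [this track, ATTEMPT-6 §2; cite: Bombieri2000, §12 eqs. (12.3)–(12.9) for the lobes] -/
theorem edgeNonnegEven_of_ineq (hcons : ConsecutivePrimes q q') {η : ℝ} (hη : 0 < η)
    (hη' : η < Real.log q / 2) (hη2 : η < Real.log 2 / 2)
    (hineq : ∀ b ∈ Icc (Real.log q / 2) (Real.log q' / 2), ∃ K : ℝ, 2 ≤ K ∧
      handoffCrossConstEven q η b ≤ lobeCoercivity (b - (Real.log q / 2 - η)) K) :
    EdgeNonnegEven q q' η := by
  intro b hb h hh heven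
  set c : ℝ := Real.log q / 2 - η with hc_def
  have hc : 0 < c := by rw [hc_def]; linarith
  -- the window is at most (log 2)/2 long (Bertrand)
  have hq0 : (0 : ℝ) < q := by exact_mod_cast hcons.1.pos
  have hwin : Real.log q' / 2 ≤ Real.log q / 2 + Real.log 2 / 2 := by
    have h2q : (q' : ℝ) ≤ 2 * q := by exact_mod_cast hcons.le_two_mul
    have hq'0 : (0 : ℝ) < q' := by exact_mod_cast hcons.2.1.pos
    have := Real.log_le_log hq'0 h2q
    rw [Real.log_mul (by norm_num) hq0.ne'] at this
    linarith
  have hcb : c < b := by rw [hc_def]; linarith [hb.1]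
  have hlen : b - c ≤ Real.log 2 := by rw [hc_def]; linarith [hb.2]
  -- the lobes; the left lobe is the mirror image of the right lobe
  set hp := edgeLobeRight c h with hp_def
  have hhp : IsWeilTest hp := isWeilTest_edgeLobeRight c hh.1
  have hcore : ∀ x : ℝ, |x| < c → h x = 0 := fun x hx ↦ hh.2.2 x (by rw [hc_def] at hx; exact hx)
  have hps : tsupport hp ⊆ Icc c b := tsupport_edgeLobeRight_subset hc hh.2.1 hcore
  have hmirror : edgeLobeLeft c h = fun x ↦ hp (-x) := edgeLobeLeft_eq_comp_neg_of_even hc.ne' heven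
  have hhm : IsWeilTest (fun x ↦ hp (-x)) := hhp.comp_neg
  -- decomposition of the energy
  have hsum : h = hp + fun x ↦ hp (-x) := by
    rw [← hmirror]
    exact (edgeLobeRight_add_edgeLobeLeft c h).symm
  have hQm : weilQuadratic (fun x ↦ hp (-x)) = weilQuadratic hp := weilQuadratic_comp_neg hp
  rw [hsum, weilQuadratic_add hhp hhm, hQm]
  simp only [Complex.add_re]
  -- the pieces
  obtain ⟨K, hK, hXK⟩ := hineq b hb
  have hS := re_weilQuadratic_lobe_ge_param hhp hcb hlen hps hK
  have hX := re_weilFunctional_cross_reflect_ge hhp hc hcb.le hps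
  have hN : ∫ u : ℝ, ‖hp (-u)‖ ^ 2 = ∫ u : ℝ, ‖hp u‖ ^ 2 := integral_neg_eq_self (fun u : ℝ ↦ ‖hp u‖ ^ 2) volume
  rw [hN, Complex.add_re] at hX
  have hXdef : handoffCrossConstEven q η b = 4 * archGapBound c * (b - c) + 2 * gapAtomSum c b := by
    rw [handoffCrossConstEven, hc_def]
  rw [hXdef] at hXK
  have hnp : 0 ≤ ∫ t : ℝ, ‖hp t‖ ^ 2 := integral_nonneg fun _ ↦ by positivity
  have h1 := mul_le_mul_of_nonneg_right hXK hnp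
  have e : (2 * (b - c) * archGapBound c + gapAtomSum c b) * (2 * ((∫ u : ℝ, ‖hp u‖ ^ 2) + ∫ u : ℝ, ‖hp u‖ ^ 2)) =
      2 * ((4 * archGapBound c * (b - c) + 2 * gapAtomSum c b) * ∫ u : ℝ, ‖hp u‖ ^ 2) := by ring
  rw [e] at hX
  linarith [hS, hX, h1]

/-- Packaged with the parity split: under the same explicit even inequality, the full edge block `EdgeNonneg q q′ η` is
equivalent to its ODD half alone — the odd sector carries the entire prime-gap proviso (ATTEMPT-4 (GAP-q)). [this track, ATTEMPT-6 §3] -/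
theorem edgeNonneg_iff_odd_of_evenIneq (hcons : ConsecutivePrimes q q') {η : ℝ} (hη : 0 < η)
    (hη' : η < Real.log q / 2) (hη2 : η < Real.log 2 / 2)
    (hineq : ∀ b ∈ Icc (Real.log q / 2) (Real.log q' / 2), ∃ K : ℝ, 2 ≤ K ∧
      handoffCrossConstEven q η b ≤ lobeCoercivity (b - (Real.log q / 2 - η)) K) :
    EdgeNonneg q q' η ↔ EdgeNonnegOdd q q' η := by
  rw [edgeNonneg_iff_even_and_odd]
  exact ⟨fun h ↦ h.2, fun h ↦ ⟨edgeNonnegEven_of_ineq hcons hη hη' hη2 hineq, h⟩⟩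

end Summit.RiemannHypothesis.RiemannHypothesis.Theorems.Handoff
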